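import Literature.MathematicalPhysics.KineticTheory.LangevinChainGibbs

/-!
# HonestZwanzig / NetworkReduction — admissible observables of the pinned chain

Support file for item `stmt-AtomisticToContinuum-12701` (`NetworkReduction` of route `HonestZwanzig`,
sub-problem `FouriersLaw`). The route decl `FeshbachIdentities` delivers its fixed-`N` package
(integrability, time reversal, Kolmogorov identities) for ADMISSIBLE observables
`Adm f :↔ Continuous f ∧ ∃ A, ∀ z, |f z| ≤ A·exp(H(z)/(8T))`. This file checks admissibility of
everything the reduction feeds into that package: constants, `p_y²`, the symmetrically split site
energies `e_x` (`0 ≤ e_x ≤ H`), the bond currents `j_b` (`|j_b| ≤ N(3+β)/2 (1+H)²`,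
`LangevinChainNESSProofs`) and the total current `J`, together with closure under sums, scalar
multiples, `z ↦ (q, −p)` and pointwise rewriting (for `L e_x` via `GeneratorSiteEnergy`), and the
parity facts `e_x∘Θ = e_x`, `j_{N−1} ≡ 0` (`J∘Θ = −J` is
`OscillatorChain.bondCurrent_neg_momentum` summed). The predicate `Adm` and the site energies `e`
are taken as variables with their defining equations as hypotheses (`Iff.rfl` / `rfl` at the
point of use), so that no new definitions are introduced.
-/

noncomputable section

open MeasureTheory Finset Real
open Literature.MathematicalPhysics.KineticTheory.HeatConduction

namespace Summit.AtomisticToContinuum.FouriersLaw.Theorems.HonestZwanzig.NetworkReduction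

section Adm

variable {ω₂ lam β γ : ℝ} {N : ℕ} {T : ℝ}
  (Adm : (PhaseSpace N → ℝ) → Prop)

/-- Admissibility is a property of the graph: pointwise equal functions are both admissible. -/
theorem adm_of_eq {f g : PhaseSpace N → ℝ} (h : ∀ z, f z = g z) (hg : Adm g) : Adm f := by
  have hfg : f = g := funext h
  rw [hfg]
  exact hg

/-- A `z`-independent case split of admissible observables is admissible. -/
theorem adm_ite (c : Prop) [Decidable c] {f g : PhaseSpace N → ℝ} (hf : Adm f) (hg : Adm g) :
    Adm (fun z => if c then f z else g z) := by
  by_cases hc : c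
  · simp only [if_pos hc]; exact hf
  · simp only [if_neg hc]; exact hg

variable (hAdm : ∀ f, Adm f ↔ (Continuous f ∧ ∃ A : ℝ, ∀ z,
    |f z| ≤ A * Real.exp ((pinnedChain ω₂ lam β γ).hamiltonian N z / (8 * T))))
include hAdm

/-- Sums of admissible observables are admissible. -/
theorem adm_add {f g : PhaseSpace N → ℝ} (hf : Adm f) (hg : Adm g) : Adm (fun z => f z + g z) := by
  rw [hAdm] at hf hg ⊢
  obtain ⟨hfc, A, hA⟩ := hf
  obtain ⟨hgc, B, hB⟩ := hg
  refine ⟨hfc.add hgc, A + B, fun z => ?_⟩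
  calc |f z + g z| ≤ |f z| + |g z| := abs_add_le _ _
    _ ≤ _ := by rw [add_mul]; exact add_le_add (hA z) (hB z)

/-- Scalar multiples of admissible observables are admissible. -/
theorem adm_const_mul (c : ℝ) {f : PhaseSpace N → ℝ} (hf : Adm f) : Adm (fun z => c * f z) := by
  rw [hAdm] at hf ⊢
  obtain ⟨hfc, A, hA⟩ := hf
  refine ⟨continuous_const.mul hfc, |c| * A, fun z => ?_⟩
  rw [abs_mul, mul_assoc]
  exact mul_le_mul_of_nonneg_left (hA z) (abs_nonneg c)

/-- Negatives of admissible observables are admissible. -/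
theorem adm_neg {f : PhaseSpace N → ℝ} (hf : Adm f) : Adm (fun z => -f z) := by
  have := adm_const_mul Adm hAdm (-1) hf
  refine adm_of_eq Adm (fun z => ?_) this
  ring

/-- Differences of admissible observables are admissible. -/
theorem adm_sub {f g : PhaseSpace N → ℝ} (hf : Adm f) (hg : Adm g) : Adm (fun z => f z - g z) := by
  have := adm_add Adm hAdm hf (adm_neg Adm hAdm hg)
  refine adm_of_eq Adm (fun z => ?_) this
  ring

/-- Finite sums of admissible observables are admissible. -/
theorem adm_sum {ι : Type*} (s : Finset ι) (F : ι → PhaseSpace N → ℝ) (hzero : Adm fun _ => 0)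
    (h : ∀ i ∈ s, Adm (F i)) : Adm (fun z => ∑ i ∈ s, F i z) := by
  classical
  induction s using Finset.induction_on with
  | empty => simpa using hzero
  | insert a s ha ih =>
    have h1 : Adm (F a) := h a (Finset.mem_insert_self a s)
    have h2 : Adm (fun z => ∑ i ∈ s, F i z) := ih fun i hi => h i (Finset.mem_insert_of_mem hi)
    refine adm_of_eq Adm (fun z => ?_) (adm_add Adm hAdm h1 h2)
    rw [Finset.sum_insert ha]

/-- Momentum reversal preserves admissibility (the energy is even in `p`). -/
theorem adm_rev {f : PhaseSpace N → ℝ} (hf : Adm f) : Adm (fun z => f (z.1, -z.2)) := by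
  rw [hAdm] at hf ⊢
  obtain ⟨hfc, A, hA⟩ := hf
  refine ⟨hfc.comp (continuous_fst.prodMk continuous_snd.neg), A, fun z => ?_⟩
  have := hA (z.1, -z.2)
  rwa [OscillatorChain.hamiltonian_neg_momentum] at this

omit hAdm in
/-- `H ≤ 8T·exp(H/(8T))` for `T > 0`. -/
theorem hamiltonian_le_exp (hT : 0 < T) (z : PhaseSpace N) :
    (pinnedChain ω₂ lam β γ).hamiltonian N z ≤
      8 * T * Real.exp ((pinnedChain ω₂ lam β γ).hamiltonian N z / (8 * T)) := by
  have h8 : 0 < 8 * T := by positivity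
  have h := Real.add_one_le_exp ((pinnedChain ω₂ lam β γ).hamiltonian N z / (8 * T))
  have h' : (pinnedChain ω₂ lam β γ).hamiltonian N z / (8 * T) ≤
      Real.exp ((pinnedChain ω₂ lam β γ).hamiltonian N z / (8 * T)) := by linarith
  rw [div_le_iff₀ h8] at h'
  linarith

/-- Constants are admissible (`H ≥ 0`, `T > 0`). -/
theorem adm_const (hω : 0 < ω₂) (hl : 0 ≤ lam) (hβ : 0 ≤ β) (hT : 0 < T) (c : ℝ) :
    Adm (fun _ => c) := by
  rw [hAdm]
  refine ⟨continuous_const, |c|, fun z => ?_⟩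
  have hH := pinnedChain_hamiltonian_nonneg hω.le hl hβ γ N z
  have : 1 ≤ Real.exp ((pinnedChain ω₂ lam β γ).hamiltonian N z / (8 * T)) :=
    Real.one_le_exp (by positivity)
  nlinarith [abs_nonneg c]

/-- `p_y²` is admissible (`p_y² ≤ 2H`). -/
theorem adm_psq (hω : 0 < ω₂) (hl : 0 ≤ lam) (hβ : 0 ≤ β) (hT : 0 < T) (y : Fin N) :
    Adm (fun z => z.2 y ^ 2) := by
  rw [hAdm]
  refine ⟨(continuous_apply y).comp continuous_snd |>.pow 2, 16 * T, fun z => ?_⟩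
  have h := pinnedChain_harmonic_le_hamiltonian (ω₂ := ω₂) hl hβ γ N z
  have h1 : z.2 y ^ 2 / 2 ≤ ∑ i, z.2 i ^ 2 / 2 :=
    Finset.single_le_sum (f := fun i => z.2 i ^ 2 / 2) (fun i _ => by positivity) (Finset.mem_univ y)
  have hω' := hω.le
  have h2 : 0 ≤ ∑ i, ω₂ * z.1 i ^ 2 / 2 := Finset.sum_nonneg fun i _ => by positivity
  have h3 := hamiltonian_le_exp (ω₂ := ω₂) (lam := lam) (β := β) (γ := γ) (N := N) hT z
  rw [abs_of_nonneg (by positivity)]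
  linarith

/-- The bond currents are admissible (`|j_b| ≤ N(3+β)/2 (1+H)²`, `(1+H)² ≤ C·e^{H/(8T)}`). -/
theorem adm_bondCurrent (hω : 0 < ω₂) (hl : 0 ≤ lam) (hβ : 0 ≤ β) (hT : 0 < T) (b : Fin N) :
    Adm ((pinnedChain ω₂ lam β γ).bondCurrent N b) := by
  rw [hAdm]
  refine ⟨pinnedChain_continuous_bondCurrent ω₂ lam β γ N b,
    N * ((3 + β) / 2 * (2 * Real.exp (1 / (8 * T)) / (1 / (8 * T)) ^ 2)), fun z => ?_⟩
  have h1 := pinnedChain_abs_bondCurrent_le hω.le hl hβ γ N b z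
  have hH := pinnedChain_hamiltonian_nonneg hω.le hl hβ γ N z
  have hs : 0 < 1 / (8 * T) := by positivity
  have h2 := one_add_sq_le_exp hH hs
  have h3 : 1 / (8 * T) * (pinnedChain ω₂ lam β γ).hamiltonian N z =
      (pinnedChain ω₂ lam β γ).hamiltonian N z / (8 * T) := by ring
  rw [h3] at h2
  calc |(pinnedChain ω₂ lam β γ).bondCurrent N b z|
      ≤ N * ((3 + β) / 2 * (1 + (pinnedChain ω₂ lam β γ).hamiltonian N z) ^ 2) := h1
    _ ≤ N * ((3 + β) / 2 * (2 * Real.exp (1 / (8 * T)) / (1 / (8 * T)) ^ 2 *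
          Real.exp ((pinnedChain ω₂ lam β γ).hamiltonian N z / (8 * T)))) := by
        gcongr
    _ = _ := by ring

/-- The total current `J = Σ_b j_b` is admissible. -/
theorem adm_totalCurrent (hω : 0 < ω₂) (hl : 0 ≤ lam) (hβ : 0 ≤ β) (hT : 0 < T) :
    Adm (fun z => ∑ i : Fin N, (pinnedChain ω₂ lam β γ).bondCurrent N i z) :=
  adm_sum Adm hAdm Finset.univ _ (adm_const Adm hAdm hω hl hβ hT 0)
    fun i _ => adm_bondCurrent Adm hAdm hω hl hβ hT i

variable (e : Fin N → PhaseSpace N → ℝ)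
  (he : ∀ x z, e x z = z.2 x ^ 2 / 2 + (pinnedChain ω₂ lam β γ).U (z.1 x) +
    ∑ j : Fin N, ((if j.val = x.val + 1 then (pinnedChain ω₂ lam β γ).V (z.1 j - z.1 x) / 2 else 0) +
      (if x.val = j.val + 1 then (pinnedChain ω₂ lam β γ).V (z.1 x - z.1 j) / 2 else 0)))
include he

omit hAdm in
/-- `0 ≤ e_x ≤ H`: every term of the split site energy is a nonnegative term of `H`. -/
theorem e_nonneg_le_hamiltonian (hω : 0 < ω₂) (hl : 0 ≤ lam) (hβ : 0 ≤ β) (x : Fin N)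
    (z : PhaseSpace N) : 0 ≤ e x z ∧ e x z ≤ (pinnedChain ω₂ lam β γ).hamiltonian N z := by
  have hU : ∀ q : ℝ, 0 ≤ (pinnedChain ω₂ lam β γ).U q := fun q => by
    show 0 ≤ ω₂ * q ^ 2 / 2 + lam * q ^ 4 / 4; positivity
  have hV : ∀ r : ℝ, 0 ≤ (pinnedChain ω₂ lam β γ).V r := fun r => by
    show 0 ≤ r ^ 2 / 2 + β * r ^ 4 / 4; positivity
  rw [he]
  constructor
  · refine add_nonneg (add_nonneg (by positivity) (hU _)) (Finset.sum_nonneg fun j _ => ?_)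
    refine add_nonneg ?_ ?_ <;> split_ifs <;> first | positivity | exact (div_nonneg (hV _) (by norm_num))
  · unfold OscillatorChain.hamiltonian
    -- the kinetic + pinning term
    have hA : z.2 x ^ 2 / 2 + (pinnedChain ω₂ lam β γ).U (z.1 x) ≤
        ∑ i, (z.2 i ^ 2 / 2 + (pinnedChain ω₂ lam β γ).U (z.1 i)) :=
      Finset.single_le_sum (f := fun i => z.2 i ^ 2 / 2 + (pinnedChain ω₂ lam β γ).U (z.1 i))
        (fun i _ => add_nonneg (by positivity) (hU _)) (Finset.mem_univ x)
    -- the double bond sum, nonnegative termwise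
    set D : Fin N → Fin N → ℝ := fun i j =>
      if j.val = i.val + 1 then (pinnedChain ω₂ lam β γ).V (z.1 j - z.1 i) else 0 with hD
    have hDnn : ∀ i j, 0 ≤ D i j := fun i j => by
      simp only [hD]; split_ifs
      · exact hV _
      · exact le_rfl
    -- right half-bonds
    have hB : ∑ j : Fin N, (if j.val = x.val + 1 then (pinnedChain ω₂ lam β γ).V (z.1 j - z.1 x) / 2
        else 0) ≤ (∑ i, ∑ j, D i j) / 2 := by
      have h1 : ∑ j : Fin N, (if j.val = x.val + 1 then (pinnedChain ω₂ lam β γ).V (z.1 j - z.1 x) / 2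
          else 0) = (∑ j, D x j) / 2 := by
        rw [Finset.sum_div]
        refine Finset.sum_congr rfl fun j _ => ?_
        simp only [hD]; split_ifs <;> simp
      rw [h1]
      exact div_le_div_of_nonneg_right (Finset.single_le_sum (f := fun i => ∑ j, D i j)
        (fun i _ => Finset.sum_nonneg fun j _ => hDnn i j) (Finset.mem_univ x)) (by norm_num)
    -- left half-bonds
    have hC : ∑ j : Fin N, (if x.val = j.val + 1 then (pinnedChain ω₂ lam β γ).V (z.1 x - z.1 j) / 2
        else 0) ≤ (∑ i, ∑ j, D i j) / 2 := by
      calc ∑ j : Fin N, (if x.val = j.val + 1 then (pinnedChain ω₂ lam β γ).V (z.1 x - z.1 j) / 2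
            else 0) ≤ ∑ i : Fin N, (∑ j, D i j) / 2 := by
            refine Finset.sum_le_sum fun i _ => ?_
            by_cases hx : x.val = i.val + 1
            · rw [if_pos hx]
              have h1 : D i x ≤ ∑ j, D i j :=
                Finset.single_le_sum (f := fun j => D i j) (fun j _ => hDnn i j) (Finset.mem_univ x)
              have h2 : D i x = (pinnedChain ω₂ lam β γ).V (z.1 x - z.1 i) := by
                simp only [hD]; rw [if_pos hx]
              rw [h2] at h1
              linarith
            · rw [if_neg hx]
              exact div_nonneg (Finset.sum_nonneg fun j _ => hDnn i j) (by norm_num)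
        _ = (∑ i, ∑ j, D i j) / 2 := by rw [Finset.sum_div]
    have hsplit : ∑ j : Fin N, ((if j.val = x.val + 1 then (pinnedChain ω₂ lam β γ).V (z.1 j - z.1 x) / 2
        else 0) + (if x.val = j.val + 1 then (pinnedChain ω₂ lam β γ).V (z.1 x - z.1 j) / 2 else 0)) =
        (∑ j : Fin N, (if j.val = x.val + 1 then (pinnedChain ω₂ lam β γ).V (z.1 j - z.1 x) / 2 else 0)) +
        ∑ j : Fin N, (if x.val = j.val + 1 then (pinnedChain ω₂ lam β γ).V (z.1 x - z.1 j) / 2 else 0) :=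
      Finset.sum_add_distrib
    rw [hsplit]
    have hDsum : (∑ i, ∑ j, D i j) = ∑ i : Fin N, ∑ j : Fin N,
        if j.val = i.val + 1 then (pinnedChain ω₂ lam β γ).V (z.1 j - z.1 i) else 0 := rfl
    linarith

/-- The split site energies are admissible. -/
theorem adm_e (hω : 0 < ω₂) (hl : 0 ≤ lam) (hβ : 0 ≤ β) (hT : 0 < T) (x : Fin N) : Adm (e x) := by
  rw [hAdm]
  have hfun : e x = fun z : PhaseSpace N => z.2 x ^ 2 / 2 + (pinnedChain ω₂ lam β γ).U (z.1 x) +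
      ∑ j : Fin N, ((if j.val = x.val + 1 then (pinnedChain ω₂ lam β γ).V (z.1 j - z.1 x) / 2 else 0) +
        (if x.val = j.val + 1 then (pinnedChain ω₂ lam β γ).V (z.1 x - z.1 j) / 2 else 0)) :=
    funext (he x)
  refine ⟨?_, 8 * T, fun z => ?_⟩
  · rw [hfun]
    have hU : Continuous (pinnedChain ω₂ lam β γ).U := by
      show Continuous fun q : ℝ => ω₂ * q ^ 2 / 2 + lam * q ^ 4 / 4; fun_prop
    have hV : Continuous (pinnedChain ω₂ lam β γ).V := by
      show Continuous fun r : ℝ => r ^ 2 / 2 + β * r ^ 4 / 4; fun_prop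
    refine Continuous.add (Continuous.add (by fun_prop) (hU.comp ((continuous_apply x).comp
      continuous_fst))) (continuous_finsetSum _ fun j _ => Continuous.add ?_ ?_)
    · by_cases h : j.val = x.val + 1
      · simp only [if_pos h]
        exact (hV.comp (((continuous_apply j).comp continuous_fst).sub
          ((continuous_apply x).comp continuous_fst))).div_const 2
      · simp only [if_neg h]; exact continuous_const
    · by_cases h : x.val = j.val + 1
      · simp only [if_pos h]
        exact (hV.comp (((continuous_apply x).comp continuous_fst).sub
          ((continuous_apply j).comp continuous_fst))).div_const 2
      · simp only [if_neg h]; exact continuous_const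
  · have h := e_nonneg_le_hamiltonian e he hω hl hβ x z
    have h3 := hamiltonian_le_exp (ω₂ := ω₂) (lam := lam) (β := β) (γ := γ) (N := N) hT z
    rw [abs_of_nonneg h.1]
    linarith [h.2]

end Adm

/-! ### Parity under momentum reversal and the missing last bond -/

/-- The split site energies are even in the momenta. -/
theorem e_neg_momentum {N : ℕ} (P : OscillatorChain) (e : Fin N → PhaseSpace N → ℝ)
    (he : ∀ x z, e x z = z.2 x ^ 2 / 2 + P.U (z.1 x) +
      ∑ j : Fin N, ((if j.val = x.val + 1 then P.V (z.1 j - z.1 x) / 2 else 0) +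
        (if x.val = j.val + 1 then P.V (z.1 x - z.1 j) / 2 else 0)))
    (x : Fin N) (z : PhaseSpace N) : e x (z.1, -z.2) = e x z := by
  rw [he, he]
  simp

/-- There is no bond to the right of the last site: `j_{N−1} ≡ 0`. -/
theorem bondCurrent_eq_zero_of_last (P : OscillatorChain) {N : ℕ} (b : Fin N) (hb : ¬ b.val + 1 < N)
    (z : PhaseSpace N) : P.bondCurrent N b z = 0 := by
  unfold OscillatorChain.bondCurrent
  refine Finset.sum_eq_zero fun j _ => ?_
  rw [if_neg]
  intro h
  exact hb (h ▸ j.isLt)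

end Summit.AtomisticToContinuum.FouriersLaw.Theorems.HonestZwanzig.NetworkReduction
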